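import Literature.AlgebraicGeometry.Motives.CMSquareDescentPair
import Literature.AlgebraicGeometry.HodgeTheory.WeilClassesTestEigenspaces
import Literature.NumberTheory.EllipticCurves.CMEndomorphismOfMulMemLattice
import HarnessLib

/-!
# The aiming lemma with the CM square: single-test Weil typing in every degree, `K`-compatibility of the weighted classes, and the reduction to the CM curve and the aiming

Family `hodge`, layer `Literature/AlgebraicGeometry/Motives`. Proof file (theorems only; no
definition, no named fact, D-0026) for the named fact
`Motives.exists_cmWeilSurface_aimedSplitProduct_of_ne_one_of_ne_three` (`Motives/AimedSplitProduct`: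
the aiming lemma of the product trick of C. Schoen, Compositio Math. 114 (1998) §10, E. Markman,
arXiv:2509.23403 §11.5 Step 2, B. van Geemen, LNM 1594, Lemma 5.2, 5.3, 5.4 — ONE Weil surface
`(B, ψ)` for `K = ℚ(√-d)` with a DESCENT PAIR `(b₊, b₋, η)`, such that `A × B` is of hyperbolic Weil
type for every Weil-type `(A, φ)` of every even dimension and a suitable hyperplane class; in print
the surface is the CM square `B = E₀ × E₀`, `E₀ = ℂ/O_K`, `K` acting through `(ι, ῑ)`). Companion
of `Motives/CMSquareDescentPair` (the surface conjunct of the fact ON THE CM SQUARE, given the CM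
curve: `exists_cmSquare_surfaceConjunct`) and of `HodgeTheory/WeilClassesTestEigenspaces` (one test
endomorphism versus all of them). This file proves, on the tree's real carriers:

* `forall_eq_of_prod_one_add_eq_pow_plus/minus` — the combinatorics of the single test
  endomorphism `(𝟙 + φ)^*` in EVERY degree for `d ∉ {1, 3}`: a sign pattern
  `ε : Fin k → {i√d, -i√d}` with `∏ᵢ (1 + εᵢ) = (1 ± i√d)ᵏ` is constant (the character
  `(1+i√d)ᵃ(1-i√d)ᵇ` collides with `(1±i√d)^{a+b}` only for `b = 0`, resp. `a = 0`:
  `Motives.weilTestCharacter_eq_pow_add_iff_right/left`, i.e. `(1-i√d)/(1+i√d)` is no root of unity,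
  `Motives/AimedSplitProduct`, `## No other collisions`);
* `eigenspace_one_add_le_weilClassesPlus/Minus_of_ne_one_of_ne_three`,
  `eigenspace_sup_le_weilClassesOf_of_ne_one_of_ne_three`,
  `weilClassesOf_eq_eigenspace_sup_of_ne_one_of_ne_three` — **for a complex abelian `2n`-fold
  `(A, φ)` with `φ ≫ φ = -(d • 𝟙 A)`, `0 < d`, `d ≠ 1`, `d ≠ 3`, the eigenspaces
  `Eig((𝟙 + φ)^*, (1 ± i√d)²ⁿ) ⊆ H²ⁿ(A(ℂ); ℂ)` ARE the Weil lines `E± = weilClassesPlus/Minus A φ n d`**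
  (joint eigenclasses of ALL the test endomorphisms `(x·𝟙 + y·φ)^*`, `HodgeTheory/WeilClasses`), by
  the engine `mem_pullbackEigenclasses_of_map_test_eq_smul` of `HodgeTheory/WeilClassesTestEigenspaces`
  (wedge eigenbasis of `H• = ⋀• H¹`; van Geemen, proof of Thm. 6.12). This is the geometric half of
  the `## Misstatement` analysis of `Motives/AimedSplitProduct` (the single-test rendering of "Weil
  type" used by the fact and by route `HeckePrymWeil` agrees with the Weil plane exactly for
  `d ∉ {1, 3}`), and converts the fact's Weil-type witness into the typing `weilClassesOf` of the
  sibling facts `HodgeTheory.exists_weilTypeSurface_prod_isHyperbolicWeilType_all`,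
  `HodgeTheory.Schoen1998_weilClasses_algebraic_of_prod_surface_all` (the converse conversion is
  `HodgeTheory.mem_eigenspace_sup_of_mem_weilClassesOf`; the surface case `2n = 2`, valid for every
  `d`, is `HodgeTheory.eigenspace_le_weilClassesPlus/Minus_two`).
* `map_two_eq_smul_of_dim_eq_one`, `map_neg_two_eq_smul_of_dim_eq_one`,
  `map_cmSquare_weightedClass`, `smul_add_map_cmSquare_weightedClass` — **the weighted product
  classes `h = m₁·pr₁^* p + m₂·pr₂^* q` of the CM square are `K`-compatible**: `[±ψ₀]^*` acts on
  `H²(E₀(ℂ); ℂ)` by `d = deg [√-d]` (`H²` is the line through `v ∪ ψ₀^* v`), hence `ψ^* h = d·h` and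
  `d·h + ψ^* h = 2d·h` for `ψ = ψ₀ × (-ψ₀)` (van Geemen 5.3: the polarizations `m₁E₀ ⊞ m₂E₀`;
  Markman §11.5 Step 2: `π₁^*h₁ + π₂^*h₂` is `η`-compatible) — so hyperbolicity for the
  `K`-symmetrised class is hyperbolicity for `h` (`isHyperbolicWeilType_smul_iff`).
* `exists_cmWeilSurface_aimedSplitProduct_of_ne_one_of_ne_three_of_cmCurve_of_aiming` — **the fact
  from its two remaining printed inputs**, each stated as a hypothesis in the tree's vocabulary
  (no named fact is introduced): (CM) for every `d ≥ 1` a complex abelian variety `E₀` of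
  dimension `1` with an endomorphism `ψ₀`, `ψ₀ ≫ ψ₀ = -(d • 𝟙)` — the CM elliptic curve `ℂ/ℤ[√-d]`
  with `[√-d]` (Silverman, AEC VI Thm. 4.1 (b); Cox, Primes of the form `x² + ny²`, Thm. 10.14 and
  Prop. 14.9), PROVED in the tree as `CMEndomorphism.exists_cmCurve_sqrt_neg`
  (`NumberTheory/EllipticCurves/CMEndomorphismOfMulMemLattice`, Milne's extension theorem and
  rigidity) — and (AIM) the aiming of the CM square in the Weil-plane typing: for every Weil-type
  `(A, φ)` of dimension `2n` (a non-zero rational `(n,n)`-class in `weilClassesOf A φ n d`) a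
  projective embedding `e` of `A × (E₀ × E₀)` and a rational `a ≠ 0` with `(A × B, φ × ψ)` of
  hyperbolic Weil type for `d·e^*a + (φ × ψ)^*e^*a` (van Geemen 5.2 (3)–(4), 5.3, 5.4 (5.4.1);
  Markman §11.5 Step 2: Hodge–Riemann in degree one for the signature `(n, n)`, the hyperplane
  class of the weighted Segre embedding, and the arithmetic `Motives.aimingArithmetic` /
  `Motives.exists_isotropic_blockVectors` and frame transport
  `Motives.isHyperbolicWeilType_prod_of_rationalModels` of the tree). Given (CM) and (AIM) the fact
  follows from the first item and `exists_cmSquare_surfaceConjunct`;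
* `exists_cmWeilSurface_aimedSplitProduct_of_ne_one_of_ne_three_of_aiming` — since (CM) is a theorem
  of the tree (`CMEndomorphism.exists_cmCurve_sqrt_neg`), **the fact follows from (AIM) alone**; and
  `…_of_exists_aimedCmCurve` — the same from ONE aimed CM curve per `d` (the form an assembly for the
  specific model `E_Λ`, `Λ = ℤ + ℤ·i√d`, is consumed in).

## References

* [Schoen1998HodgeWeilAddendum] C. Schoen, Addendum to: Hodge classes on self-products of a variety
  with an automorphism, Compositio Math. 114 (1998) 329–336, §10 (proof of the Proposition).
* [Markman2025SurveySecant] E. Markman, Secant sheaves and Weil classes on abelian varieties,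
  arXiv:2509.23403, §11.5 Step 2.
* [vanGeemen1994HodgeAV] B. van Geemen, An introduction to the Hodge conjecture for abelian
  varieties, LNM 1594 (1994), 4.9, Lemma 5.2 (2)–(6) and its proof, 5.3, 5.4 (5.4.1), proof of
  Thm. 6.12.
* [LangeBirkenhake1992] H. Lange, Ch. Birkenhake, Complex Abelian Varieties (1992), Lemma 1.1.17.
* [SilvermanAEC2009] J. H. Silverman, The Arithmetic of Elliptic Curves, 2nd ed. (2009), VI Thm. 4.1 (b).
-/

noncomputable section

open CategoryTheory
open Literature.AlgebraicTopology.SingularHomology Literature.AlgebraicGeometry.HodgeTheory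

namespace Literature.AlgebraicGeometry.Motives

/-! ### Sign patterns matched by the single test value `(1, 1)` in every degree -/

section SignPatterns

/-- A sign pattern `ε : Fin k → {i√d, -i√d}` has `∏ᵢ (1 + εᵢ) = (1 + i√d)ᵃ (1 - i√d)ᵇ` with
`a + b = k`, `a` (`b`) the number of `+` (`-`) signs; `b = 0` (`a = 0`) means the pattern is
constant `+` (`-`). [folklore] -/
theorem exists_prod_one_add_eq_pow_mul_pow {d k : ℕ} (ε : Fin k → ℂ)
    (hε : ∀ i, ε i = Complex.I * (Real.sqrt d : ℂ) ∨ ε i = -(Complex.I * (Real.sqrt d : ℂ))) :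
    ∃ a b : ℕ, a + b = k ∧
      (∏ i, ((1 : ℂ) + 1 * ε i)) =
        (1 + Complex.I * (Real.sqrt d : ℂ)) ^ a * (1 - Complex.I * (Real.sqrt d : ℂ)) ^ b ∧
      (b = 0 → ∀ i, ε i = Complex.I * (Real.sqrt d : ℂ)) ∧
      (a = 0 → ∀ i, ε i = -(Complex.I * (Real.sqrt d : ℂ))) := by
  classical
  set μ : ℂ := Complex.I * (Real.sqrt d : ℂ) with hμ
  refine ⟨(Finset.univ.filter fun i : Fin k => ε i = μ).card,
    (Finset.univ.filter fun i : Fin k => ¬ ε i = μ).card, ?_, ?_, ?_, ?_⟩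
  · rw [Finset.card_filter_add_card_filter_not, Finset.card_univ, Fintype.card_fin]
  · rw [← Finset.prod_filter_mul_prod_filter_not Finset.univ (fun i : Fin k => ε i = μ)]
    congr 1
    · refine (Finset.prod_congr rfl fun i hi => ?_).trans (Finset.prod_const _)
      rw [(Finset.mem_filter.1 hi).2, one_mul]
    · refine (Finset.prod_congr rfl fun i hi => ?_).trans (Finset.prod_const _)
      have hi' : ε i = -μ := (hε i).resolve_left (Finset.mem_filter.1 hi).2
      rw [hi', one_mul, sub_eq_add_neg]
  · intro hb i
    by_contra hi
    have hmem : i ∈ Finset.univ.filter fun i : Fin k => ¬ ε i = μ :=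
      Finset.mem_filter.2 ⟨Finset.mem_univ _, hi⟩
    rw [Finset.card_eq_zero.1 hb] at hmem
    exact Finset.notMem_empty _ hmem
  · intro ha i
    refine (hε i).resolve_left fun hi => ?_
    have hmem : i ∈ Finset.univ.filter fun i : Fin k => ε i = μ :=
      Finset.mem_filter.2 ⟨Finset.mem_univ _, hi⟩
    rw [Finset.card_eq_zero.1 ha] at hmem
    exact Finset.notMem_empty _ hmem

/-- **No collision with the `+` Weil character, combinatorial form (`d ∉ {1, 3}`)**: a sign pattern
`ε : Fin k → {i√d, -i√d}` with `∏ᵢ (1 + εᵢ) = (1 + i√d)ᵏ` is constant `+i√d` — the character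
`(1+i√d)ᵃ(1-i√d)ᵇ`, `a + b = k`, equals `(1+i√d)ᵏ` only for `b = 0`
(`weilTestCharacter_eq_pow_add_iff_right`). [folklore] -/
theorem forall_eq_of_prod_one_add_eq_pow_plus {d k : ℕ} (hd : 0 < d) (h1 : d ≠ 1) (h3 : d ≠ 3)
    (ε : Fin k → ℂ)
    (hε : ∀ i, ε i = Complex.I * (Real.sqrt d : ℂ) ∨ ε i = -(Complex.I * (Real.sqrt d : ℂ)))
    (hprod : (∏ i, ((1 : ℂ) + 1 * ε i)) = (1 + Complex.I * (Real.sqrt d : ℂ)) ^ k) :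
    ∀ i, ε i = Complex.I * (Real.sqrt d : ℂ) := by
  obtain ⟨a, b, hab, hp, hb, -⟩ := exists_prod_one_add_eq_pow_mul_pow ε hε
  refine hb ((weilTestCharacter_eq_pow_add_iff_right hd h1 h3 (a := a) (b := b)).1 ?_)
  rw [← hp, hprod, hab]

/-- **No collision with the `-` Weil character, combinatorial form (`d ∉ {1, 3}`)**: a sign pattern
with `∏ᵢ (1 + εᵢ) = (1 - i√d)ᵏ` is constant `-i√d` (`weilTestCharacter_eq_pow_add_iff_left`).
[folklore] -/
theorem forall_eq_of_prod_one_add_eq_pow_minus {d k : ℕ} (hd : 0 < d) (h1 : d ≠ 1) (h3 : d ≠ 3)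
    (ε : Fin k → ℂ)
    (hε : ∀ i, ε i = Complex.I * (Real.sqrt d : ℂ) ∨ ε i = -(Complex.I * (Real.sqrt d : ℂ)))
    (hprod : (∏ i, ((1 : ℂ) + 1 * ε i)) = (1 - Complex.I * (Real.sqrt d : ℂ)) ^ k) :
    ∀ i, ε i = -(Complex.I * (Real.sqrt d : ℂ)) := by
  obtain ⟨a, b, hab, hp, -, ha⟩ := exists_prod_one_add_eq_pow_mul_pow ε hε
  refine ha ((weilTestCharacter_eq_pow_add_iff_left hd h1 h3 (a := a) (b := b)).1 ?_)
  rw [← hp, hprod, hab]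

end SignPatterns

/-! ### Every even dimension: the single-test eigenspaces are the Weil lines for `d ∉ {1, 3}` -/

section SingleTest

variable {A : AbelianVariety ℂ} {φ : A ⟶ A} {n d : ℕ}

/-- **`Eig((𝟙 + φ)^*, (1 + i√d)²ⁿ) ⊆ E₊` on a `2n`-fold, `d ∉ {1, 3}`.** For a complex abelian
variety `A` of dimension `2n` with `φ ≫ φ = -(d • 𝟙 A)`, `0 < d`, `d ≠ 1`, `d ≠ 3`, every class
`c ∈ H²ⁿ(A(ℂ); ℂ)` with `(𝟙 + φ)^* c = (1 + i√d)²ⁿ c` is a joint eigenclass of all the test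
endomorphisms, `(x·𝟙 + y·φ)^* c = (x + y i√d)²ⁿ c` (`weilClassesPlus A φ n d = ⋀²ⁿ V₊`): in the
wedge eigenbasis of `H²ⁿ = ⋀²ⁿ(V₊ ⊕ V₋)` (engine `mem_pullbackEigenclasses_of_map_test_eq_smul`)
the coordinates of `c` sit at sign patterns `ε` with `∏ (1 + εᵢ) = (1 + i√d)²ⁿ`, which are
constant `+` (`forall_eq_of_prod_one_add_eq_pow_plus`). [cite: vanGeemen1994HodgeAV, 4.9, proof of Lemma 5.2 (6) and of Thm. 6.12] -/
theorem eigenspace_one_add_le_weilClassesPlus_of_ne_one_of_ne_three (hA : A.dim = 2 * n)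
    (hd : 0 < d) (h1 : d ≠ 1) (h3 : d ≠ 3) (hφ : φ ≫ φ = -(d • 𝟙 A)) :
    Module.End.eigenspace (complexBetti.map (𝟙 A + φ).hom.hom.hom (2 * n)).hom
        ((1 + Complex.I * (Real.sqrt (d : ℝ) : ℂ)) ^ (2 * n)) ≤ weilClassesPlus A φ n d := by
  intro c hc
  rw [Module.End.mem_eigenspace_iff] at hc
  have hc' : complexBetti.map ((1 : ℕ) • 𝟙 A + (1 : ℕ) • φ).hom.hom.hom (2 * n) c =
      ((1 + Complex.I * (Real.sqrt d : ℂ)) ^ (2 * n)) • c := by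
    rw [complexBetti_map_one_add_eq]; exact hc
  have hb₁ : Module.finrank ℂ (complexBetti A.X 1) = 2 * (2 * n) := by
    rw [surface_finrank_complexBetti_one, hA]
  refine mem_pullbackEigenclasses_of_map_test_eq_smul (k := 2 * n)
    (surface_hasExteriorCohomologyH1 A) hb₁ hd hφ 1 1
    ((1 + Complex.I * (Real.sqrt d : ℂ)) ^ (2 * n))
    (fun x y => ((x : ℂ) + (y : ℂ) * Complex.I * (Real.sqrt d : ℂ)) ^ (2 * n)) ?_ hc'
  intro ε hε hprod x y
  have hall := forall_eq_of_prod_one_add_eq_pow_plus hd h1 h3 ε hε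
    (by rw [← hprod]; simp only [Nat.cast_one])
  rw [Finset.prod_congr rfl fun i _ => by rw [hall i], Finset.prod_const, Finset.card_univ,
    Fintype.card_fin]
  ring

/-- **`Eig((𝟙 + φ)^*, (1 - i√d)²ⁿ) ⊆ E₋` on a `2n`-fold, `d ∉ {1, 3}`** (`weilClassesMinus A φ n d =
⋀²ⁿ V₋`; sign patterns matched by `(1 - i√d)²ⁿ` are constant `-`).
[cite: vanGeemen1994HodgeAV, 4.9, proof of Lemma 5.2 (6) and of Thm. 6.12] -/
theorem eigenspace_one_add_le_weilClassesMinus_of_ne_one_of_ne_three (hA : A.dim = 2 * n)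
    (hd : 0 < d) (h1 : d ≠ 1) (h3 : d ≠ 3) (hφ : φ ≫ φ = -(d • 𝟙 A)) :
    Module.End.eigenspace (complexBetti.map (𝟙 A + φ).hom.hom.hom (2 * n)).hom
        ((1 - Complex.I * (Real.sqrt (d : ℝ) : ℂ)) ^ (2 * n)) ≤ weilClassesMinus A φ n d := by
  intro c hc
  rw [Module.End.mem_eigenspace_iff] at hc
  have hc' : complexBetti.map ((1 : ℕ) • 𝟙 A + (1 : ℕ) • φ).hom.hom.hom (2 * n) c =
      ((1 - Complex.I * (Real.sqrt d : ℂ)) ^ (2 * n)) • c := by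
    rw [complexBetti_map_one_add_eq]; exact hc
  have hb₁ : Module.finrank ℂ (complexBetti A.X 1) = 2 * (2 * n) := by
    rw [surface_finrank_complexBetti_one, hA]
  refine mem_pullbackEigenclasses_of_map_test_eq_smul (k := 2 * n)
    (surface_hasExteriorCohomologyH1 A) hb₁ hd hφ 1 1
    ((1 - Complex.I * (Real.sqrt d : ℂ)) ^ (2 * n))
    (fun x y => ((x : ℂ) - (y : ℂ) * Complex.I * (Real.sqrt d : ℂ)) ^ (2 * n)) ?_ hc'
  intro ε hε hprod x y
  have hall := forall_eq_of_prod_one_add_eq_pow_minus hd h1 h3 ε hε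
    (by rw [← hprod]; simp only [Nat.cast_one])
  rw [Finset.prod_congr rfl fun i _ => by rw [hall i], Finset.prod_const, Finset.card_univ,
    Fintype.card_fin]
  ring

/-- **The single-test Weil span lies in the Weil plane (`d ∉ {1, 3}`)**:
`Eig((𝟙+φ)^*, (1+i√d)²ⁿ) ⊔ Eig((𝟙+φ)^*, (1-i√d)²ⁿ) ≤ weilClassesOf A φ n d` on a `2n`-fold with
`φ ≫ φ = -(d • 𝟙 A)`. [cite: vanGeemen1994HodgeAV, 4.9 and proof of Thm. 6.12] -/
theorem eigenspace_sup_le_weilClassesOf_of_ne_one_of_ne_three (hA : A.dim = 2 * n) (hd : 0 < d)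
    (h1 : d ≠ 1) (h3 : d ≠ 3) (hφ : φ ≫ φ = -(d • 𝟙 A)) :
    Module.End.eigenspace (complexBetti.map (𝟙 A + φ).hom.hom.hom (2 * n)).hom
          ((1 + Complex.I * (Real.sqrt (d : ℝ) : ℂ)) ^ (2 * n)) ⊔
        Module.End.eigenspace (complexBetti.map (𝟙 A + φ).hom.hom.hom (2 * n)).hom
          ((1 - Complex.I * (Real.sqrt (d : ℝ) : ℂ)) ^ (2 * n)) ≤
      weilClassesOf A φ n d :=
  sup_le_sup (eigenspace_one_add_le_weilClassesPlus_of_ne_one_of_ne_three hA hd h1 h3 hφ)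
    (eigenspace_one_add_le_weilClassesMinus_of_ne_one_of_ne_three hA hd h1 h3 hφ)

/-- **The Weil plane IS the single-test Weil span for `d ∉ {1, 3}`**:
`weilClassesOf A φ n d = Eig((𝟙+φ)^*, (1+i√d)²ⁿ) ⊔ Eig((𝟙+φ)^*, (1-i√d)²ⁿ)` on a `2n`-fold with
`φ ≫ φ = -(d • 𝟙 A)` (the other inclusion, valid for every `d`, is
`HodgeTheory.mem_eigenspace_sup_of_mem_weilClassesOf`). For `d ∈ {1, 3}` and `2n ≥ 6`, resp.
`2n ≥ 4`, the right side is strictly larger (`Motives/AimedSplitProduct`, `## Misstatement`).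
[cite: vanGeemen1994HodgeAV, 4.9 and proof of Thm. 6.12] -/
theorem weilClassesOf_eq_eigenspace_sup_of_ne_one_of_ne_three (hA : A.dim = 2 * n) (hd : 0 < d)
    (h1 : d ≠ 1) (h3 : d ≠ 3) (hφ : φ ≫ φ = -(d • 𝟙 A)) :
    weilClassesOf A φ n d =
      Module.End.eigenspace (complexBetti.map (𝟙 A + φ).hom.hom.hom (2 * n)).hom
          ((1 + Complex.I * (Real.sqrt (d : ℝ) : ℂ)) ^ (2 * n)) ⊔
        Module.End.eigenspace (complexBetti.map (𝟙 A + φ).hom.hom.hom (2 * n)).hom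
          ((1 - Complex.I * (Real.sqrt (d : ℝ) : ℂ)) ^ (2 * n)) :=
  le_antisymm (fun _ hc => mem_eigenspace_sup_of_mem_weilClassesOf hc)
    (eigenspace_sup_le_weilClassesOf_of_ne_one_of_ne_three hA hd h1 h3 hφ)

end SingleTest

/-! ### `K`-compatibility of the weighted product classes on the CM square: `ψ^* h = d·h` -/

section KSymmetrised

variable {E₀ : AbelianVariety ℂ} {d : ℕ} {ψ₀ : E₀ ⟶ E₀}

/-- **`ψ₀^*` acts on `H²(E₀(ℂ); ℂ)` by `d`** (`dim E₀ = 1`, `ψ₀ ≫ ψ₀ = -(d • 𝟙)`, `d ≥ 1`; in print: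
`deg [√-d] = N(√-d) = d`). On the carriers: `H²(E₀(ℂ))` is the line through `v ∪ ψ₀^* v` (`v ≠ 0`
rational; `b₁ = 2`, `H• = ⋀• H¹`, `cupProduct_map_one_ne_zero`) and
`ψ₀^*(v ∪ ψ₀^* v) = ψ₀^* v ∪ (ψ₀^*)² v = ψ₀^* v ∪ (-d·v) = d · v ∪ ψ₀^* v`.
[cite: vanGeemen1994HodgeAV, 5.3] [cite: LangeBirkenhake1992, Lemma 1.1.17] -/
theorem map_two_eq_smul_of_dim_eq_one (hE : E₀.dim = 1) (hd : 0 < d)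
    (hψ : ψ₀ ≫ ψ₀ = -(d • 𝟙 E₀)) (c : complexBetti E₀.X 2) :
    complexBetti.map ψ₀.hom.hom.hom 2 c = (d : ℂ) • c := by
  classical
  obtain ⟨v, hv, hv0⟩ := exists_isRationalClass_ne_zero_one hE
  set T := (complexBetti.map ψ₀.hom.hom.hom 1).hom with hTdef
  set P' := cupProduct (X := ComplexPoints E₀.X) (R := ℂ) (rfl : 1 + 1 = 2) with hP'
  have hvt : P' v (T v) ≠ 0 := cupProduct_map_one_ne_zero hE hd hψ hv hv0
  haveI : Module.Finite ℂ (complexBetti E₀.X 1) := finite_complexBetti_abelianVariety E₀ 1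
  haveI : Module.Finite ℂ (complexBetti E₀.X 2) := finite_complexBetti_abelianVariety E₀ 2
  have hfin : Module.finrank ℂ (complexBetti E₀.X 2) = 1 := by
    have h := (surface_hasExteriorCohomologyH1 E₀).finrank_eq 2
    rw [finrank_complexBetti_one_of_dim_eq_one hE] at h
    simpa using h
  obtain ⟨t, ht⟩ := (finrank_eq_one_iff_of_nonzero' (P' v (T v)) hvt).1 hfin c
  have hT2 : T (T v) = -((d : ℂ) • v) := complexBetti_map_map_one_of_comp_self hψ v
  have htv : P' (T v) v = -P' v (T v) := by
    have h := cupProduct_gradedComm_holds ℂ (ComplexPoints E₀.X) (rfl : 1 + 1 = 2) rfl (T v) v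
    simpa using h
  have hmap : complexBetti.map ψ₀.hom.hom.hom 2 (P' v (T v)) = (d : ℂ) • P' v (T v) := by
    change singularCohomology.map ℂ ℂ _ 2 (cupProduct rfl v (T v)) = _
    rw [cupProduct_map]
    change P' (T v) (T (T v)) = _
    rw [hT2, map_neg, map_smul, htv, smul_neg, neg_neg]
  rw [← ht, map_smul, hmap, smul_comm]

/-- **`(-ψ₀)^*` acts on `H²(E₀(ℂ); ℂ)` by `d` as well** (`(-ψ₀)^* = -ψ₀^*` on `H¹`, so
`(-ψ₀)^*(a ∪ b) = ψ₀^* a ∪ ψ₀^* b` on `H² = ⋀²H¹`). [cite: vanGeemen1994HodgeAV, 5.3]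
[cite: LangeBirkenhake1992, Lemma 1.1.17] -/
theorem map_neg_two_eq_smul_of_dim_eq_one (hE : E₀.dim = 1) (hd : 0 < d)
    (hψ : ψ₀ ≫ ψ₀ = -(d • 𝟙 E₀)) (c : complexBetti E₀.X 2) :
    complexBetti.map (-ψ₀).hom.hom.hom 2 c = (d : ℂ) • c := by
  classical
  obtain ⟨v, hv, hv0⟩ := exists_isRationalClass_ne_zero_one hE
  set T := (complexBetti.map ψ₀.hom.hom.hom 1).hom with hTdef
  set P' := cupProduct (X := ComplexPoints E₀.X) (R := ℂ) (rfl : 1 + 1 = 2) with hP'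
  have hvt : P' v (T v) ≠ 0 := cupProduct_map_one_ne_zero hE hd hψ hv hv0
  haveI : Module.Finite ℂ (complexBetti E₀.X 1) := finite_complexBetti_abelianVariety E₀ 1
  haveI : Module.Finite ℂ (complexBetti E₀.X 2) := finite_complexBetti_abelianVariety E₀ 2
  have hfin : Module.finrank ℂ (complexBetti E₀.X 2) = 1 := by
    have h := (surface_hasExteriorCohomologyH1 E₀).finrank_eq 2
    rw [finrank_complexBetti_one_of_dim_eq_one hE] at h
    simpa using h
  obtain ⟨t, ht⟩ := (finrank_eq_one_iff_of_nonzero' (P' v (T v)) hvt).1 hfin c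
  have hT2 : T (T v) = -((d : ℂ) • v) := complexBetti_map_map_one_of_comp_self hψ v
  have hnegT : ∀ a, complexBetti.map (-ψ₀).hom.hom.hom 1 a = -(T a) := fun a ↦ by
    rw [complexBetti_map_neg_one]; rfl
  have htv : P' (T v) v = -P' v (T v) := by
    have h := cupProduct_gradedComm_holds ℂ (ComplexPoints E₀.X) (rfl : 1 + 1 = 2) rfl (T v) v
    simpa using h
  have hmap : complexBetti.map (-ψ₀).hom.hom.hom 2 (P' v (T v)) = (d : ℂ) • P' v (T v) := by
    change singularCohomology.map ℂ ℂ _ 2 (cupProduct rfl v (T v)) = _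
    rw [cupProduct_map]
    change P' (complexBetti.map (-ψ₀).hom.hom.hom 1 v) (complexBetti.map (-ψ₀).hom.hom.hom 1 (T v)) = _
    rw [hnegT, hnegT, hT2]
    simp only [map_neg, LinearMap.neg_apply, neg_neg, map_smul, htv]
  rw [← ht, map_smul, hmap, smul_comm]

/-- **The weighted product classes of the CM square are `K`-compatible**: on `B = E₀ × E₀` with
`ψ = ψ₀ × (-ψ₀)`, every class `h = m₁·pr₁^* p + m₂·pr₂^* q` (`p, q ∈ H²(E₀(ℂ); ℂ)`; in print the
polarization `m₁E₀ ⊞ m₂E₀` of van Geemen 5.3, the hyperplane class of a weighted Segre embedding)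
satisfies `ψ^* h = d · h` (`ψ^* pr₁^* = pr₁^* ψ₀^*`, `ψ^* pr₂^* = pr₂^* (-ψ₀)^*`, and both act by `d` on
`H²(E₀)`), hence its `K`-symmetrisation is `d·h + ψ^* h = 2d·h` (Markman §11.5 Step 2: the product
polarization `π₁^*h₁ + π₂^*h₂` is `η`-compatible). [cite: vanGeemen1994HodgeAV, 5.3]
[cite: Markman2025SurveySecant, §11.5 Step 2] -/
theorem map_cmSquare_weightedClass (hE : E₀.dim = 1) (hd : 0 < d) (hψ : ψ₀ ≫ ψ₀ = -(d • 𝟙 E₀))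
    (m₁ m₂ : ℂ) (p q : complexBetti E₀.X 2) :
    complexBetti.map (AbelianVariety.prodLift (AbelianVariety.fst E₀ E₀ ≫ ψ₀)
        (AbelianVariety.snd E₀ E₀ ≫ (-ψ₀))).hom.hom.hom 2
        (m₁ • complexBetti.map (AbelianVariety.fst E₀ E₀).hom.hom.hom 2 p +
          m₂ • complexBetti.map (AbelianVariety.snd E₀ E₀).hom.hom.hom 2 q) =
      (d : ℂ) • (m₁ • complexBetti.map (AbelianVariety.fst E₀ E₀).hom.hom.hom 2 p +
          m₂ • complexBetti.map (AbelianVariety.snd E₀ E₀).hom.hom.hom 2 q) := by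
  set Φ := AbelianVariety.prodLift (AbelianVariety.fst E₀ E₀ ≫ ψ₀)
    (AbelianVariety.snd E₀ E₀ ≫ (-ψ₀)) with hΦ
  have h1 : complexBetti.map Φ.hom.hom.hom 2 (complexBetti.map (AbelianVariety.fst E₀ E₀).hom.hom.hom 2 p) =
      (d : ℂ) • complexBetti.map (AbelianVariety.fst E₀ E₀).hom.hom.hom 2 p := by
    change singularCohomology.map ℂ ℂ _ 2 (singularCohomology.map ℂ ℂ _ 2 p) = _
    rw [abelianVarietyHom_map_map_apply, AbelianVariety.prodLift_fst, ← abelianVarietyHom_map_map_apply]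
    change complexBetti.map (AbelianVariety.fst E₀ E₀).hom.hom.hom 2 (complexBetti.map ψ₀.hom.hom.hom 2 p) = _
    rw [map_two_eq_smul_of_dim_eq_one hE hd hψ, map_smul]
  have h2 : complexBetti.map Φ.hom.hom.hom 2 (complexBetti.map (AbelianVariety.snd E₀ E₀).hom.hom.hom 2 q) =
      (d : ℂ) • complexBetti.map (AbelianVariety.snd E₀ E₀).hom.hom.hom 2 q := by
    change singularCohomology.map ℂ ℂ _ 2 (singularCohomology.map ℂ ℂ _ 2 q) = _
    rw [abelianVarietyHom_map_map_apply, AbelianVariety.prodLift_snd, ← abelianVarietyHom_map_map_apply]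
    change complexBetti.map (AbelianVariety.snd E₀ E₀).hom.hom.hom 2
      (complexBetti.map (-ψ₀).hom.hom.hom 2 q) = _
    rw [map_neg_two_eq_smul_of_dim_eq_one hE hd hψ, map_smul]
  rw [map_add, map_smul, map_smul, h1, h2, smul_add, smul_comm m₁, smul_comm m₂]

/-- **The `K`-symmetrised weighted product class is `2d` times the class**:
`d·h + ψ^* h = (2d)·h` for `h = m₁·pr₁^* p + m₂·pr₂^* q` on the CM square (so, by
`isHyperbolicWeilType_smul_iff`, hyperbolicity for `d·h + ψ^*h` is hyperbolicity for `h`).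
[cite: vanGeemen1994HodgeAV, 5.3] [cite: Markman2025SurveySecant, §11.5 Step 2] -/
theorem smul_add_map_cmSquare_weightedClass (hE : E₀.dim = 1) (hd : 0 < d)
    (hψ : ψ₀ ≫ ψ₀ = -(d • 𝟙 E₀)) (m₁ m₂ : ℂ) (p q : complexBetti E₀.X 2) :
    (d : ℂ) • (m₁ • complexBetti.map (AbelianVariety.fst E₀ E₀).hom.hom.hom 2 p +
          m₂ • complexBetti.map (AbelianVariety.snd E₀ E₀).hom.hom.hom 2 q) +
      complexBetti.map (AbelianVariety.prodLift (AbelianVariety.fst E₀ E₀ ≫ ψ₀)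
        (AbelianVariety.snd E₀ E₀ ≫ (-ψ₀))).hom.hom.hom 2
        (m₁ • complexBetti.map (AbelianVariety.fst E₀ E₀).hom.hom.hom 2 p +
          m₂ • complexBetti.map (AbelianVariety.snd E₀ E₀).hom.hom.hom 2 q) =
      (2 * d : ℂ) • (m₁ • complexBetti.map (AbelianVariety.fst E₀ E₀).hom.hom.hom 2 p +
          m₂ • complexBetti.map (AbelianVariety.snd E₀ E₀).hom.hom.hom 2 q) := by
  rw [map_cmSquare_weightedClass hE hd hψ, ← add_smul]
  congr 1
  ring

end KSymmetrised

/-! ### The fact from the CM curve and the aiming of the CM square -/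

section Reduction

/-- **`exists_cmWeilSurface_aimedSplitProduct_of_ne_one_of_ne_three` from its two remaining
printed inputs.** GIVEN (CM) for every `d ≥ 1`, `d ≠ 1, 3`, a complex abelian variety `E₀` of
dimension `1` with an endomorphism `ψ₀`, `ψ₀ ≫ ψ₀ = -(d • 𝟙 E₀)` — the CM elliptic curve
`ℂ/ℤ[√-d]` with `[√-d]` as a morphism of abelian varieties (Silverman AEC VI Thm. 5.3, Prop. 5.4;
Cox, Thm. 10.14 and Prop. 14.9; van Geemen 5.3 "`E` an elliptic curve with CM by `O_K`") — and
(AIM) the AIMING of the CM square in the Weil-plane typing: for such `(E₀, ψ₀)` and every complex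
abelian `2n`-fold `(A, φ)`, `φ ≫ φ = -(d • 𝟙 A)`, carrying a non-zero rational `(n,n)`-class in
`weilClassesOf A φ n d`, a projective embedding `e` of `A × (E₀ × E₀)` and a rational `a ≠ 0` of
`H²(ℙᴺ(ℂ); ℂ)` with `(A × (E₀ × E₀), φ × (ψ₀ × (-ψ₀)))` of hyperbolic Weil type in half-dimension
`n + 1` for `d·e^*a + (φ × ψ)^*e^*a` (Markman §11.5 Step 2; van Geemen Lemma 5.2 (2)–(4), 5.3,
5.4 (5.4.1): the signature `(n, n)` of the Hermitian form of the `K`-symmetrised hyperplane class —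
Hodge–Riemann in degree one —, the hyperplane class of the weighted Segre embedding, every class
`-q` a discriminant of `m₁E₀ ⊞ m₂E₀`, Landherr; the arithmetic is the tree's
`Motives.exists_isotropic_blockVectors`, the frame transport
`Motives.isHyperbolicWeilType_prod_of_rationalModels`; (AIM) includes `n = 0`, where `A` is a
point and it asserts the hyperbolicity of `(E₀ × E₀, ψ₀ × (-ψ₀))` itself for the `K`-symmetrised
hyperplane class of an equal-weight embedding, `m₁ = m₂`, van Geemen 5.3 with `a = 1`), THEN the
fact holds: the surface is
`B = E₀ × E₀`, `ψ = ψ₀ × (-ψ₀)` with the descent pair of `Motives.exists_cmSquare_surfaceConjunct`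
(file `Motives/CMSquareDescentPair`), and the
fact's single-test Weil-type witness of `(A, φ)` is a Weil-plane witness for `d ∉ {1, 3}`
(`eigenspace_sup_le_weilClassesOf_of_ne_one_of_ne_three`). No named fact is introduced: (CM) and
(AIM) are hypotheses. [cite: Markman2025SurveySecant, §11.5 Step 2]
[cite: vanGeemen1994HodgeAV, Lemma 5.2 (2)–(6), 5.3 and 5.4 (5.4.1)]
[cite: Schoen1998HodgeWeilAddendum, §10 (proof of the Proposition)] -/
theorem exists_cmWeilSurface_aimedSplitProduct_of_ne_one_of_ne_three_of_cmCurve_of_aiming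
    (hCM : ∀ d : ℕ, 0 < d → d ≠ 1 → d ≠ 3 →
      ∃ (E₀ : AbelianVariety ℂ) (ψ₀ : E₀ ⟶ E₀), E₀.dim = 1 ∧ ψ₀ ≫ ψ₀ = -(d • 𝟙 E₀))
    (hAim : ∀ d : ℕ, 0 < d → d ≠ 1 → d ≠ 3 → ∀ (E₀ : AbelianVariety ℂ) (ψ₀ : E₀ ⟶ E₀),
      E₀.dim = 1 → ψ₀ ≫ ψ₀ = -(d • 𝟙 E₀) →
      ∀ (n : ℕ) (A : AbelianVariety ℂ) (φ : A ⟶ A), A.dim = 2 * n → φ ≫ φ = -(d • 𝟙 A) →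
        (∃ c : complexBetti A.X (2 * n), IsRationalClass c ∧
          IsOfHodgeType (2 * n) A.X (2 * n) n n c ∧ c ∈ weilClassesOf A φ n d ∧ c ≠ 0) →
        ∃ (e : ProjectiveEmbedding (A.prod (E₀.prod E₀)).X)
          (a : complexBetti (projectiveSpace e.n ℂ) 2), IsRationalClass a ∧ a ≠ 0 ∧
          IsHyperbolicWeilType (A.prod (E₀.prod E₀))
            (AbelianVariety.prodLift (AbelianVariety.fst A (E₀.prod E₀) ≫ φ)
              (AbelianVariety.snd A (E₀.prod E₀) ≫
                AbelianVariety.prodLift (AbelianVariety.fst E₀ E₀ ≫ ψ₀)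
                  (AbelianVariety.snd E₀ E₀ ≫ (-ψ₀))))
            (n + 1)
            ((d : ℂ) • complexBetti.map e.ι 2 a +
              complexBetti.map (AbelianVariety.prodLift (AbelianVariety.fst A (E₀.prod E₀) ≫ φ)
                (AbelianVariety.snd A (E₀.prod E₀) ≫
                  AbelianVariety.prodLift (AbelianVariety.fst E₀ E₀ ≫ ψ₀)
                    (AbelianVariety.snd E₀ E₀ ≫ (-ψ₀)))).hom.hom.hom 2
                (complexBetti.map e.ι 2 a))) :
    exists_cmWeilSurface_aimedSplitProduct_of_ne_one_of_ne_three := by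
  intro d hd h1 h3
  obtain ⟨E₀, ψ₀, hE, hψ⟩ := hCM d hd h1 h3
  obtain ⟨hBdim, hΦΦ, bp, bm, η, hbp, hbm, hrat, htype, hη, hbpη, hbmη⟩ :=
    exists_cmSquare_surfaceConjunct hE hd hψ
  refine ⟨E₀.prod E₀, _, hBdim, hΦΦ, ⟨bp, bm, η, hbp, hbm, hrat, htype, hη, hbpη, hbmη⟩, ?_⟩
  intro n A φ hA hφ hc
  obtain ⟨c, hc0, hcr, hct, hcE⟩ := hc
  have hφ' : φ ≫ φ = -(d • 𝟙 A) := by rw [hφ, natCast_zsmul]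
  exact hAim d hd h1 h3 E₀ ψ₀ hE hψ n A φ hA hφ'
    ⟨c, hcr, hct, eigenspace_sup_le_weilClassesOf_of_ne_one_of_ne_three hA hd h1 h3 hφ' hcE, hc0⟩

end Reduction

/-! ### Assembly: the CM curve is in the tree, so the fact is the aiming alone -/

section Assembly

/-- **The fact from ONE aimed CM curve per `d`.** If for every `d ≥ 1`, `d ∉ {1, 3}`, SOME complex
elliptic curve `E₀` (`dim E₀ = 1`) with `ψ₀ ≫ ψ₀ = -(d • 𝟙)` has the aiming property (AIM) of
`exists_cmWeilSurface_aimedSplitProduct_of_ne_one_of_ne_three_of_cmCurve_of_aiming` — for every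
Weil-type `(A, φ)` of dimension `2n` (Weil-plane typing) a projective embedding `e` of
`A × (E₀ × E₀)` and a rational `a ≠ 0` with `(A × (E₀ × E₀), φ × (ψ₀ × (-ψ₀)))` of hyperbolic Weil
type for `d·e^*a + (φ × ψ)^*e^*a` — then the fact holds (same proof; this is the form in which an
assembly for ONE model of `ℂ/(ℤ + ℤ√-d)`, e.g. the curve `E_Λ`, `Λ = ℤ + ℤ·i√d`, of
`CMEndomorphism.exists_cmCurve_sqrt`, is consumed). [cite: Markman2025SurveySecant, §11.5 Step 2]
[cite: vanGeemen1994HodgeAV, Lemma 5.2 (2)–(6), 5.3 and 5.4 (5.4.1)] -/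
theorem exists_cmWeilSurface_aimedSplitProduct_of_ne_one_of_ne_three_of_exists_aimedCmCurve
    (h : ∀ d : ℕ, 0 < d → d ≠ 1 → d ≠ 3 → ∃ (E₀ : AbelianVariety ℂ) (ψ₀ : E₀ ⟶ E₀),
      E₀.dim = 1 ∧ ψ₀ ≫ ψ₀ = -(d • 𝟙 E₀) ∧
      ∀ (n : ℕ) (A : AbelianVariety ℂ) (φ : A ⟶ A), A.dim = 2 * n → φ ≫ φ = -(d • 𝟙 A) →
        (∃ c : complexBetti A.X (2 * n), IsRationalClass c ∧
          IsOfHodgeType (2 * n) A.X (2 * n) n n c ∧ c ∈ weilClassesOf A φ n d ∧ c ≠ 0) →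
        ∃ (e : ProjectiveEmbedding (A.prod (E₀.prod E₀)).X)
          (a : complexBetti (projectiveSpace e.n ℂ) 2), IsRationalClass a ∧ a ≠ 0 ∧
          IsHyperbolicWeilType (A.prod (E₀.prod E₀))
            (AbelianVariety.prodLift (AbelianVariety.fst A (E₀.prod E₀) ≫ φ)
              (AbelianVariety.snd A (E₀.prod E₀) ≫
                AbelianVariety.prodLift (AbelianVariety.fst E₀ E₀ ≫ ψ₀)
                  (AbelianVariety.snd E₀ E₀ ≫ (-ψ₀))))
            (n + 1)
            ((d : ℂ) • complexBetti.map e.ι 2 a +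
              complexBetti.map (AbelianVariety.prodLift (AbelianVariety.fst A (E₀.prod E₀) ≫ φ)
                (AbelianVariety.snd A (E₀.prod E₀) ≫
                  AbelianVariety.prodLift (AbelianVariety.fst E₀ E₀ ≫ ψ₀)
                    (AbelianVariety.snd E₀ E₀ ≫ (-ψ₀)))).hom.hom.hom 2
                (complexBetti.map e.ι 2 a))) :
    exists_cmWeilSurface_aimedSplitProduct_of_ne_one_of_ne_three := by
  intro d hd h1 h3
  obtain ⟨E₀, ψ₀, hE, hψ, hAim⟩ := h d hd h1 h3
  obtain ⟨hBdim, hΦΦ, bp, bm, η, hbp, hbm, hrat, htype, hη, hbpη, hbmη⟩ :=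
    exists_cmSquare_surfaceConjunct hE hd hψ
  refine ⟨E₀.prod E₀, _, hBdim, hΦΦ, ⟨bp, bm, η, hbp, hbm, hrat, htype, hη, hbpη, hbmη⟩, ?_⟩
  intro n A φ hA hφ hc
  obtain ⟨c, hc0, hcr, hct, hcE⟩ := hc
  have hφ' : φ ≫ φ = -(d • 𝟙 A) := by rw [hφ, natCast_zsmul]
  exact hAim n A φ hA hφ'
    ⟨c, hcr, hct, eigenspace_sup_le_weilClassesOf_of_ne_one_of_ne_three hA hd h1 h3 hφ' hcE, hc0⟩

/-- **The fact is the aiming alone**: hypothesis (CM) of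
`exists_cmWeilSurface_aimedSplitProduct_of_ne_one_of_ne_three_of_cmCurve_of_aiming` is a THEOREM of
the tree — for every `d ≥ 1` the CM curve `ℂ/(ℤ + ℤ√-d)` with `[√-d]` as an `AbelianVariety ℂ`
endomorphism, `ψ₀ ≫ ψ₀ = -(d • 𝟙)` (`CMEndomorphism.exists_cmCurve_sqrt_neg`, file
`NumberTheory/EllipticCurves/CMEndomorphismOfMulMemLattice`: transformation polynomials of `℘(wz)`,
the chart algebra map, Milne's extension theorem and rigidity; Silverman AEC Thm. VI.4.1 (b)) — so
the fact follows from the aiming (AIM) of the CM squares alone (Markman §11.5 Step 2; van Geemen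
Lemma 5.2 (2)–(4), 5.3, 5.4: Hodge–Riemann in degree one for the signature `(n, n)`, the hyperplane
class of the weighted Segre embedding, Landherr). [cite: Markman2025SurveySecant, §11.5 Step 2]
[cite: vanGeemen1994HodgeAV, Lemma 5.2 (2)–(4), 5.3 and 5.4 (5.4.1)]
[cite: SilvermanAEC2009, Thm. VI.4.1 (b)] -/
theorem exists_cmWeilSurface_aimedSplitProduct_of_ne_one_of_ne_three_of_aiming
    (hAim : ∀ d : ℕ, 0 < d → d ≠ 1 → d ≠ 3 → ∀ (E₀ : AbelianVariety ℂ) (ψ₀ : E₀ ⟶ E₀),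
      E₀.dim = 1 → ψ₀ ≫ ψ₀ = -(d • 𝟙 E₀) →
      ∀ (n : ℕ) (A : AbelianVariety ℂ) (φ : A ⟶ A), A.dim = 2 * n → φ ≫ φ = -(d • 𝟙 A) →
        (∃ c : complexBetti A.X (2 * n), IsRationalClass c ∧
          IsOfHodgeType (2 * n) A.X (2 * n) n n c ∧ c ∈ weilClassesOf A φ n d ∧ c ≠ 0) →
        ∃ (e : ProjectiveEmbedding (A.prod (E₀.prod E₀)).X)
          (a : complexBetti (projectiveSpace e.n ℂ) 2), IsRationalClass a ∧ a ≠ 0 ∧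
          IsHyperbolicWeilType (A.prod (E₀.prod E₀))
            (AbelianVariety.prodLift (AbelianVariety.fst A (E₀.prod E₀) ≫ φ)
              (AbelianVariety.snd A (E₀.prod E₀) ≫
                AbelianVariety.prodLift (AbelianVariety.fst E₀ E₀ ≫ ψ₀)
                  (AbelianVariety.snd E₀ E₀ ≫ (-ψ₀))))
            (n + 1)
            ((d : ℂ) • complexBetti.map e.ι 2 a +
              complexBetti.map (AbelianVariety.prodLift (AbelianVariety.fst A (E₀.prod E₀) ≫ φ)
                (AbelianVariety.snd A (E₀.prod E₀) ≫
                  AbelianVariety.prodLift (AbelianVariety.fst E₀ E₀ ≫ ψ₀)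
                    (AbelianVariety.snd E₀ E₀ ≫ (-ψ₀)))).hom.hom.hom 2
                (complexBetti.map e.ι 2 a))) :
    exists_cmWeilSurface_aimedSplitProduct_of_ne_one_of_ne_three :=
  exists_cmWeilSurface_aimedSplitProduct_of_ne_one_of_ne_three_of_cmCurve_of_aiming
    (fun d hd _ _ ↦ Literature.NumberTheory.EllipticCurves.CMEndomorphism.exists_cmCurve_sqrt_neg d hd)
    hAim

end Assembly

end Literature.AlgebraicGeometry.Motives

end
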